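import Mathlib.LinearAlgebra.FiniteDimensional.Lemmas
import Mathlib.LinearAlgebra.Matrix.ConjTranspose
import Mathlib.LinearAlgebra.Complex.FiniteDimensional
import Mathlib.Order.CompleteLattice.Finset
import Mathlib.Algebra.Order.BigOperators.Group.Finset
import Mathlib.Tactic.NoncommRing
import Mathlib.Tactic.Linarith
import Mathlib.Tactic.Push

/-!
# Crux `BrascampLiebVacuumSC` (stmt-QuantumFields-16404), line `SketchIdeator1`, skeleton v8:
# helpers for the stub `stub_abelianThird` (abelian subalgebras of a simple compact Lie algebra)

Skeleton v8 (`Cruxes/BrascampLiebVacuumSC/Lines/SketchIdeator1.lean`, lead c4) contains the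
classification-free root count `3 · dim A < dim L` for an abelian subspace `A` of a bracket-closed
subspace `L ⊆ 𝔲(N)` without non-trivial ideals and of dimension `> 3`, GIVEN the weight decomposition
`L_ℂ = ⨁_w E_w` of `L_ℂ = span_ℂ L` under `ad A` and the real structure of `L_ℂ`. This file holds the
sorry-free generic helpers of that count:

* `finrank_biSup_eq_sum`: the dimension of a finite independent supremum is the sum of the dimensions;
* `exists_half`, `card_eq_two_mul_card`: a finite set of weights `Φ = −Φ` not containing `0` splits as
  `R ⊔ (−R)`, so `|Φ| = 2|R|`;
* `finrank_le_card`, `exists_dual_vector`: if the functionals in `R` separate the points of `V` then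
  `dim V ≤ |R|`, and in the equality case every `β ∈ R` has a dual vector `H` (`β H = 1`, `w H = 0` for
  `w ∈ R ∖ {β}`);
* `not_weights`: with such an `H`, `2β, −2β, γ ± β` (`γ ≠ 0, ±β` a weight) are not weights;
* `lie_mem_pairIdeal_of_mem_iSup`, `disjoint_pairIdeal`: then
  `P = E_β ⊔ E_{−β} ⊔ span [E_β, E_{−β}]` is an ideal of `⨆_w E_w`, disjoint from every other weight
  space (the lemmas take `P` together with its defining equation `hP`, so that no definition is needed);
* `centre_free`, `span_le_weightZero`: an element of `L` commuting with `L` vanishes, and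
  `span_ℂ A ≤ E_0`;
* `stub_abelianThirdIdeal`: the ideal property in closed form (registered sub-goal).

No named facts are used.
-/

set_option autoImplicit false

open scoped BigOperators Matrix

namespace Summit.QuantumFields.YangMills.Theorems.BrascampLiebVacuumSC

namespace AbelianThird

/-! ### Dimension of a finite independent supremum -/

/-- For an independent family of subspaces, `dim (⨆_{w ∈ S} E w) = Σ_{w ∈ S} dim (E w)` for every
finite `S`. [folklore] -/
theorem finrank_biSup_eq_sum {K V ι : Type*} [DivisionRing K] [AddCommGroup V] [Module K V]
    [FiniteDimensional K V] {E : ι → Submodule K V} (hE : iSupIndep E) (S : Finset ι) :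
    Module.finrank K ↥(⨆ w ∈ S, E w) = ∑ w ∈ S, Module.finrank K ↥(E w) := by
  classical
  induction S using Finset.induction_on with
  | empty => simp
  | insert a S ha ih =>
    rw [Finset.iSup_insert, Finset.sum_insert ha, ← ih]
    have hdisj : Disjoint (E a) (⨆ w ∈ S, E w) :=
      hE.disjoint_biSup (y := (↑S : Set ι)) (by simpa using ha)
    have h := Submodule.finrank_sup_add_finrank_inf_eq (E a) (⨆ w ∈ S, E w)
    rw [hdisj.eq_bot, finrank_bot, add_zero] at h
    exact h

/-! ### Halving a finite symmetric set of weights -/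

/-- A finite subset `Φ` of an additive group with `Φ = −Φ` and `−w ≠ w` on `Φ` contains a set of
representatives `R` of the pairs `{w, −w}`. [folklore] -/
theorem exists_half {α : Type*} [AddGroup α] [DecidableEq α] (Φ : Finset α)
    (h0 : ∀ w ∈ Φ, -w ≠ w) (hsymm : ∀ w ∈ Φ, -w ∈ Φ) :
    ∃ R : Finset α, R ⊆ Φ ∧ (∀ w ∈ Φ, w ∈ R ∨ -w ∈ R) ∧ ∀ w ∈ R, -w ∉ R := by
  induction Φ using Finset.strongInduction with
  | H Φ ih =>
    rcases Φ.eq_empty_or_nonempty with hΦ | ⟨w₀, hw₀⟩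
    · exact ⟨∅, Finset.empty_subset _, by simp [hΦ], by simp⟩
    · have hsub : Φ \ {w₀, -w₀} ⊂ Φ :=
        Finset.sdiff_ssubset (by simp [Finset.insert_subset_iff, hw₀, hsymm w₀ hw₀]) (by simp)
      have hmem : ∀ w, w ∈ Φ \ {w₀, -w₀} ↔ w ∈ Φ ∧ w ≠ w₀ ∧ w ≠ -w₀ := fun w => by simp
      obtain ⟨R', hR', hcov', hdisj'⟩ := ih _ hsub (fun w hw => h0 w ((hmem w).1 hw).1)
        (fun w hw => by
          obtain ⟨hwΦ, hw1, hw2⟩ := (hmem w).1 hw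
          exact (hmem _).2 ⟨hsymm w hwΦ, fun h => hw2 (by rw [← h, neg_neg]),
            fun h => hw1 (neg_injective h)⟩)
      refine ⟨insert w₀ R', ?_, fun w hw => ?_, fun w hw => ?_⟩
      · exact Finset.insert_subset hw₀ (hR'.trans Finset.sdiff_subset)
      · by_cases hw1 : w = w₀
        · exact Or.inl (by simp [hw1])
        by_cases hw2 : w = -w₀
        · exact Or.inr (by simp [hw2])
        rcases hcov' w ((hmem w).2 ⟨hw, hw1, hw2⟩) with h | h
        · exact Or.inl (Finset.mem_insert_of_mem h)
        · exact Or.inr (Finset.mem_insert_of_mem h)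
      · rw [Finset.mem_insert] at hw ⊢
        rintro (h | h)
        · rcases hw with rfl | hw
          · exact h0 w hw₀ h
          · exact ((hmem _).1 (hR' hw)).2.2 (by rw [← h, neg_neg])
        · rcases hw with rfl | hw
          · exact ((hmem _).1 (hR' h)).2.2 rfl
          · exact hdisj' w hw h

/-- With `R` as in `exists_half`, `|Φ| = 2 |R|`. [folklore] -/
theorem card_eq_two_mul_card {α : Type*} [AddGroup α] [DecidableEq α] {Φ R : Finset α}
    (hsymm : ∀ w ∈ Φ, -w ∈ Φ) (hR : R ⊆ Φ) (hcov : ∀ w ∈ Φ, w ∈ R ∨ -w ∈ R)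
    (hdisj : ∀ w ∈ R, -w ∉ R) : Φ.card = 2 * R.card := by
  have hΦ : Φ = R ∪ R.image (fun w => -w) := by
    ext w
    simp only [Finset.mem_union, Finset.mem_image]
    refine ⟨fun hw => ?_, ?_⟩
    · rcases hcov w hw with h | h
      · exact Or.inl h
      · exact Or.inr ⟨-w, h, neg_neg w⟩
    · rintro (h | ⟨u, hu, rfl⟩)
      · exact hR h
      · exact hsymm u (hR hu)
  have hd : Disjoint R (R.image (fun w => -w)) := by
    rw [Finset.disjoint_left]
    rintro w hw hw'
    obtain ⟨u, hu, rfl⟩ := Finset.mem_image.1 hw'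
    exact hdisj u hu hw
  rw [hΦ, Finset.card_union_of_disjoint hd, Finset.card_image_of_injective _ neg_injective]
  ring

/-! ### Finite sets of functionals separating points -/

section Dual

variable {V : Type*} [AddCommGroup V] [Module ℝ V]

/-- The joint evaluation `H ↦ (w H)_{w ∈ R}` is injective when `R` separates points. [folklore] -/
theorem evalPi_injective (R : Finset (V →ₗ[ℝ] ℝ)) (hsep : ∀ H : V, (∀ w ∈ R, w H = 0) → H = 0) :
    Function.Injective (LinearMap.pi fun w : ↥R => (w : V →ₗ[ℝ] ℝ)) := by
  rw [← LinearMap.ker_eq_bot, Submodule.eq_bot_iff]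
  intro H hH
  rw [LinearMap.mem_ker] at hH
  exact hsep H fun w hw => by simpa using congr_fun hH ⟨w, hw⟩

/-- If finitely many functionals `R` separate the points of `V`, then `dim V ≤ |R|`. [folklore] -/
theorem finrank_le_card [FiniteDimensional ℝ V] (R : Finset (V →ₗ[ℝ] ℝ))
    (hsep : ∀ H : V, (∀ w ∈ R, w H = 0) → H = 0) : Module.finrank ℝ V ≤ R.card :=
  (LinearMap.finrank_le_finrank_of_injective (evalPi_injective R hsep)).trans_eq
    (by rw [Module.finrank_fintype_fun_eq_card, Fintype.card_coe])

/-- If finitely many functionals `R` separate the points of `V` and `|R| ≤ dim V`, then every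
`β ∈ R` has a dual vector: `β H = 1` and `w H = 0` for `w ∈ R ∖ {β}`. [folklore] -/
theorem exists_dual_vector [FiniteDimensional ℝ V] (R : Finset (V →ₗ[ℝ] ℝ))
    (hsep : ∀ H : V, (∀ w ∈ R, w H = 0) → H = 0) (hcard : R.card ≤ Module.finrank ℝ V)
    (β : V →ₗ[ℝ] ℝ) (hβ : β ∈ R) : ∃ H : V, β H = 1 ∧ ∀ w ∈ R, w ≠ β → w H = 0 := by
  classical
  have hinj := evalPi_injective R hsep
  have heq : Module.finrank ℝ V = Module.finrank ℝ (↥R → ℝ) :=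
    le_antisymm (LinearMap.finrank_le_finrank_of_injective hinj)
      (by rw [Module.finrank_fintype_fun_eq_card, Fintype.card_coe]; exact hcard)
  obtain ⟨H, hH⟩ := (LinearMap.injective_iff_surjective_of_finrank_eq_finrank heq).1 hinj
    (fun w => if (w : V →ₗ[ℝ] ℝ) = β then 1 else 0)
  refine ⟨H, ?_, fun w hw hwβ => ?_⟩
  · simpa using congr_fun hH ⟨β, hβ⟩
  · simpa [hwβ] using congr_fun hH ⟨w, hw⟩

/-- **Excluded weights.** If `β H = 1` and every "weight" `w` (predicate `P`) other than `±β`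
vanishes at `H`, then `2β`, `−2β` and `γ ± β` (for a weight `γ ≠ 0, ±β`) are not weights. [folklore] -/
theorem not_weights (P : (V →ₗ[ℝ] ℝ) → Prop) (β : V →ₗ[ℝ] ℝ) (H : V) (hβ : β H = 1)
    (hP : ∀ w, P w → w ≠ β → w ≠ -β → w H = 0) :
    ¬ P (β + β) ∧ ¬ P (-β + -β) ∧
      ∀ γ, P γ → γ ≠ 0 → γ ≠ β → γ ≠ -β → ¬ P (γ + β) ∧ ¬ P (γ + -β) := by
  have key : ∀ w, P w → w H ≠ 0 → w = β ∨ w = -β := by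
    intro w hw hne
    by_contra h
    push Not at h
    exact hne (hP w hw h.1 h.2)
  have ev : ∀ {w w' : V →ₗ[ℝ] ℝ}, w = w' → w H = w' H := fun h => by rw [h]
  refine ⟨fun h => ?_, fun h => ?_, fun γ hγ hγ0 hγβ hγnβ => ⟨fun h => ?_, fun h => ?_⟩⟩
  · rcases key _ h (by simp [hβ]) with h' | h' <;>
      · have h'' := ev h'
        simp only [LinearMap.add_apply, LinearMap.neg_apply, hβ] at h''
        norm_num at h''
  · rcases key _ h (by simp [hβ]) with h' | h' <;>
      · have h'' := ev h'
        simp only [LinearMap.add_apply, LinearMap.neg_apply, hβ] at h''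
        norm_num at h''
  · have hγH : γ H = 0 := hP γ hγ hγβ hγnβ
    rcases key _ h (by simp [hβ, hγH]) with h' | h'
    · exact hγ0 (add_eq_right.1 h')
    · have h'' := ev h'
      simp only [LinearMap.add_apply, LinearMap.neg_apply, hβ, hγH] at h''
      norm_num at h''
  · have hγH : γ H = 0 := hP γ hγ hγβ hγnβ
    rcases key _ h (by simp [hβ, hγH]) with h' | h'
    · have h'' := ev h'
      simp only [LinearMap.add_apply, LinearMap.neg_apply, hβ, hγH] at h''
      norm_num at h''
    · exact hγ0 (add_eq_right.1 h')

end Dual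

/-! ### The ideal attached to an isolated pair of weights -/

section Ideal

variable {K : Type*} [Field K] {A : Type*} [Ring A] [Algebra K A] {ι : Type*} [AddCommGroup ι]
  (E : ι → Submodule K A) (β : ι) {P : Submodule K A}
  (hP : P = E β ⊔ E (-β) ⊔ Submodule.span K {T | ∃ Z ∈ E β, ∃ W ∈ E (-β), T = Z * W - W * Z})
include hP

/-- `E_β ≤ P` for the candidate ideal `P = E_β ⊔ E_{−β} ⊔ span [E_β, E_{−β}]`. [folklore] -/
theorem mem_pairIdeal_left {Y : A} (h : Y ∈ E β) : Y ∈ P :=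
  hP ▸ Submodule.mem_sup_left (Submodule.mem_sup_left h)

/-- `E_{−β} ≤ P`. [folklore] -/
theorem mem_pairIdeal_right {Y : A} (h : Y ∈ E (-β)) : Y ∈ P :=
  hP ▸ Submodule.mem_sup_left (Submodule.mem_sup_right h)

/-- `[E_β, E_{−β}] ⊆ P`. [folklore] -/
theorem lie_mem_pairIdeal_gen {Z W : A} (hZ : Z ∈ E β) (hW : W ∈ E (-β)) : Z * W - W * Z ∈ P :=
  hP ▸ Submodule.mem_sup_right (Submodule.subset_span ⟨Z, hZ, W, hW, rfl⟩)

variable (hE5 : ∀ w w', ∀ Z ∈ E w, ∀ W ∈ E w', Z * W - W * Z ∈ E (w + w'))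
include hE5

/-- `P ≤ E_β ⊔ E_{−β} ⊔ E_0`. [folklore] -/
theorem pairIdeal_le : P ≤ E β ⊔ E (-β) ⊔ E 0 := by
  rw [hP]
  refine sup_le (sup_le (le_sup_left.trans le_sup_left) (le_sup_right.trans le_sup_left))
    (Submodule.span_le.2 ?_)
  rintro _ ⟨Z, hZ, W, hW, rfl⟩
  exact Submodule.mem_sup_right (by simpa using hE5 _ _ Z hZ W hW)

/-- `P` is disjoint from every weight space `E_{β₂}`, `β₂ ∉ {β, −β, 0}`, of an independent family.
[folklore] -/
theorem disjoint_pairIdeal (hE2 : iSupIndep E) {β₂ : ι} (h1 : β₂ ≠ β) (h2 : β₂ ≠ -β)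
    (h3 : β₂ ≠ 0) : Disjoint (E β₂) P := by
  refine (hE2.disjoint_biSup (y := ({β, -β, 0} : Set ι)) (by simp [h1, h2, h3])).mono_right ?_
  refine (pairIdeal_le E β hP hE5).trans (sup_le (sup_le ?_ ?_) ?_) <;> exact le_biSup E (by simp)

/-- **The ideal property on weight vectors.** If `2β`, `−2β` and `γ ± β` (`γ ≠ 0, ±β` a weight) are
not weights, then `[E_γ, P] ⊆ P` for every `γ` (root-string bookkeeping plus the Jacobi identity).
[folklore] -/
theorem lie_mem_pairIdeal (h2 : E (β + β) = ⊥) (h2' : E (-β + -β) = ⊥)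
    (hiso : ∀ γ, E γ ≠ ⊥ → γ ≠ 0 → γ ≠ β → γ ≠ -β → E (γ + β) = ⊥ ∧ E (γ + -β) = ⊥)
    {γ : ι} {X : A} (hX : X ∈ E γ) {T : A} (hT : T ∈ P) : X * T - T * X ∈ P := by
  by_cases hX0 : X = 0
  · simp [hX0]
  have hγ : E γ ≠ ⊥ := fun h => hX0 (by simpa [h] using hX)
  have zero_of_bot : ∀ {w : ι} {Y : A}, Y ∈ E w → E w = ⊥ → Y = 0 := fun hY hw => by
    simpa [hw] using hY
  let f : A →ₗ[K] A := LinearMap.mulLeft K X - LinearMap.mulRight K X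
  suffices h : E β ⊔ E (-β) ⊔ Submodule.span K {T | ∃ Z ∈ E β, ∃ W ∈ E (-β), T = Z * W - W * Z} ≤
      P.comap f by
    rw [hP] at hT
    simpa [f] using h hT
  refine sup_le (sup_le (fun T hT => ?_) (fun T hT => ?_)) (Submodule.span_le.2 ?_)
  · -- `T ∈ E β`
    simp only [Submodule.mem_comap, LinearMap.sub_apply, LinearMap.mulLeft_apply,
      LinearMap.mulRight_apply, f]
    have h := hE5 _ _ X hX T hT
    rcases eq_or_ne γ 0 with rfl | hγ0
    · exact mem_pairIdeal_left E β hP (by simpa using h)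
    rcases eq_or_ne γ β with rfl | hγβ
    · rw [zero_of_bot h h2]; exact zero_mem _
    rcases eq_or_ne γ (-β) with rfl | hγnβ
    · rw [show X * T - T * X = -(T * X - X * T) by noncomm_ring]
      exact neg_mem (lie_mem_pairIdeal_gen E β hP hT hX)
    · rw [zero_of_bot h (hiso γ hγ hγ0 hγβ hγnβ).1]; exact zero_mem _
  · -- `T ∈ E (-β)`
    simp only [Submodule.mem_comap, LinearMap.sub_apply, LinearMap.mulLeft_apply,
      LinearMap.mulRight_apply, f]
    have h := hE5 _ _ X hX T hT
    rcases eq_or_ne γ 0 with rfl | hγ0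
    · exact mem_pairIdeal_right E β hP (by simpa using h)
    rcases eq_or_ne γ β with rfl | hγβ
    · exact lie_mem_pairIdeal_gen E γ hP hX hT
    rcases eq_or_ne γ (-β) with rfl | hγnβ
    · rw [zero_of_bot h h2']; exact zero_mem _
    · rw [zero_of_bot h (hiso γ hγ hγ0 hγβ hγnβ).2]; exact zero_mem _
  · -- generators `Z * W - W * Z`
    rintro _ ⟨Z, hZ, W, hW, rfl⟩
    simp only [SetLike.mem_coe, Submodule.mem_comap, LinearMap.sub_apply, LinearMap.mulLeft_apply,
      LinearMap.mulRight_apply, f]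
    rw [show X * (Z * W - W * Z) - (Z * W - W * Z) * X =
        ((X * Z - Z * X) * W - W * (X * Z - Z * X)) + (Z * (X * W - W * X) - (X * W - W * X) * Z) by
      noncomm_ring]
    have hZ' := hE5 _ _ X hX Z hZ
    have hW' := hE5 _ _ X hX W hW
    rcases eq_or_ne γ 0 with rfl | hγ0
    · exact add_mem (lie_mem_pairIdeal_gen E β hP (by simpa using hZ') hW)
        (lie_mem_pairIdeal_gen E β hP hZ (by simpa using hW'))
    rcases eq_or_ne γ β with rfl | hγβ
    · rw [zero_of_bot hZ' h2, zero_mul, mul_zero, sub_zero, zero_add]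
      exact mem_pairIdeal_left E γ hP (by simpa using hE5 _ _ Z hZ _ hW')
    rcases eq_or_ne γ (-β) with rfl | hγnβ
    · rw [zero_of_bot hW' h2', zero_mul, mul_zero, sub_zero, add_zero]
      exact mem_pairIdeal_right E β hP (by simpa using hE5 _ _ _ hZ' W hW)
    · rw [zero_of_bot hZ' (hiso γ hγ hγ0 hγβ hγnβ).1, zero_of_bot hW' (hiso γ hγ hγ0 hγβ hγnβ).2]
      simp

/-- **The ideal property.** Under the hypotheses of `lie_mem_pairIdeal`, `P` is stable under `ad X`
for every `X ∈ ⨆_w E_w`. [folklore] -/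
theorem lie_mem_pairIdeal_of_mem_iSup (h2 : E (β + β) = ⊥) (h2' : E (-β + -β) = ⊥)
    (hiso : ∀ γ, E γ ≠ ⊥ → γ ≠ 0 → γ ≠ β → γ ≠ -β → E (γ + β) = ⊥ ∧ E (γ + -β) = ⊥)
    {X : A} (hX : X ∈ ⨆ w, E w) : ∀ T ∈ P, X * T - T * X ∈ P := by
  induction hX using Submodule.iSup_induction' with
  | mem γ X hX => exact fun T hT => lie_mem_pairIdeal E β hP hE5 h2 h2' hiso hX hT
  | zero => intro T _; simp
  | add X Y _ _ ihX ihY =>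
    intro T hT
    rw [show (X + Y) * T - T * (X + Y) = (X * T - T * X) + (Y * T - T * Y) by noncomm_ring]
    exact add_mem (ihX T hT) (ihY T hT)

end Ideal

/-! ### Two facts about the real subspace `L` -/

/-- In a bracket-closed real subspace `L` of dimension `> 3` (indeed `> 1`) all of whose ideals are
trivial, an element commuting with `L` vanishes (its span is an ideal). [folklore] -/
theorem centre_free {N : ℕ} {L : Submodule ℝ (Matrix (Fin N) (Fin N) ℂ)}
    (hsimple : ∀ I : Submodule ℝ (Matrix (Fin N) (Fin N) ℂ), I ≤ L →
      (∀ X ∈ L, ∀ Y ∈ I, X * Y - Y * X ∈ I) → I = ⊥ ∨ I = L)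
    (hdim : 3 < Module.finrank ℝ ↥L) {H : Matrix (Fin N) (Fin N) ℂ} (hH : H ∈ L)
    (hc : ∀ X ∈ L, H * X = X * H) : H = 0 := by
  by_contra hH0
  have hideal : ∀ X ∈ L, ∀ Y ∈ (ℝ ∙ H), X * Y - Y * X ∈ (ℝ ∙ H) := by
    intro X hX Y hY
    obtain ⟨t, rfl⟩ := Submodule.mem_span_singleton.1 hY
    rw [mul_smul_comm, smul_mul_assoc, hc X hX, sub_self]
    exact zero_mem _
  rcases hsimple (ℝ ∙ H) ((Submodule.span_singleton_le_iff_mem _ _).2 hH) hideal with h | h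
  · exact hH0 ((Submodule.mem_bot ℝ).1 (h ▸ Submodule.mem_span_singleton_self H))
  · have : Module.finrank ℝ ↥L = 1 := by rw [← h, finrank_span_singleton hH0]
    omega

/-- For an abelian `A ≤ L`, the complex span of `A` lies in the zero weight space. [folklore] -/
theorem span_le_weightZero {N : ℕ} {L A : Submodule ℝ (Matrix (Fin N) (Fin N) ℂ)} (hAL : A ≤ L)
    (hAab : ∀ H ∈ A, ∀ H' ∈ A, H * H' = H' * H)
    {E : (↥A →ₗ[ℝ] ℝ) → Submodule ℂ (Matrix (Fin N) (Fin N) ℂ)}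
    (hE1 : ∀ w, (E w : Set (Matrix (Fin N) (Fin N) ℂ)) =
      {Z | Z ∈ Submodule.span ℂ (L : Set (Matrix (Fin N) (Fin N) ℂ)) ∧
        ∀ H : ↥A, (H : Matrix (Fin N) (Fin N) ℂ) * Z - Z * (H : Matrix (Fin N) (Fin N) ℂ) =
          ((((w H : ℝ) : ℂ)) * Complex.I) • Z}) :
    Submodule.span ℂ (A : Set (Matrix (Fin N) (Fin N) ℂ)) ≤ E 0 := by
  rw [Submodule.span_le]
  intro Z hZ
  rw [hE1 0]
  refine ⟨Submodule.subset_span (hAL hZ), fun H => ?_⟩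
  simp only [LinearMap.zero_apply, Complex.ofReal_zero, zero_mul, zero_smul, sub_eq_zero]
  exact hAab _ H.2 Z hZ

end AbelianThird

/-- **Registered sub-goal `stub_abelianThirdIdeal` of `stub_abelianThird`** (the ideal property
`AbelianThird.lie_mem_pairIdeal_of_mem_iSup` in closed form): for a family `E` of subspaces of
`M_N(ℂ)` indexed by an additive group with `[E_w, E_{w'}] ⊆ E_{w+w'}`, if `E_{2β} = E_{−2β} = 0` and
`E_{γ±β} = 0` for every `γ ∉ {0, ±β}` with `E_γ ≠ 0`, then `E_β ⊔ E_{−β} ⊔ span [E_β, E_{−β}]` is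
stable under `ad X` for all `X ∈ ⨆_w E_w`. [folklore] -/
theorem stub_abelianThirdIdeal :
    ∀ (N : ℕ) (ι : Type) [AddCommGroup ι] (E : ι → Submodule ℂ (Matrix (Fin N) (Fin N) ℂ)) (β : ι),
      (∀ w w', ∀ Z ∈ E w, ∀ W ∈ E w', Z * W - W * Z ∈ E (w + w')) →
      E (β + β) = ⊥ → E (-β + -β) = ⊥ →
      (∀ γ, E γ ≠ ⊥ → γ ≠ 0 → γ ≠ β → γ ≠ -β → E (γ + β) = ⊥ ∧ E (γ + -β) = ⊥) →
      ∀ X ∈ (⨆ w, E w),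
        ∀ T ∈ E β ⊔ E (-β) ⊔ Submodule.span ℂ {T | ∃ Z ∈ E β, ∃ W ∈ E (-β), T = Z * W - W * Z},
          X * T - T * X ∈
            E β ⊔ E (-β) ⊔ Submodule.span ℂ {T | ∃ Z ∈ E β, ∃ W ∈ E (-β), T = Z * W - W * Z} :=
  fun _N _ι _ E β hE5 h2 h2' hiso _X hX =>
    AbelianThird.lie_mem_pairIdeal_of_mem_iSup E β rfl hE5 h2 h2' hiso hX

end Summit.QuantumFields.YangMills.Theorems.BrascampLiebVacuumSC
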